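import Summits.BirchSwinnertonDyer.Rank1Residual.X4.OldEigenSymbOfIhara
import HarnessLib

/-!
# The `ℓ`-old shape is FORCED: an `ℓ`-old eigen-decomposition on `H₁(X₀(Mℓ), ℤ)` is the `ℓ`-stabilised one (Ihara BY NAME + `U_ℓ` on `ℓ`-old forms) (cell `b2b-bsdres`, seat additive-p4, line V44/V45)

HONEST FRAMING (verbatim, cell `b2b-bsdres`): the goal of the cell is to DELETE the COMBINATION-SHAPED
residual classes for ALL analytic-rank `≤ 1` curves over `ℚ` — "full BSD formula for every rank `≤ 1`
curve in class `C`" assembled STRICTLY from published theorems — so that the rank-`≤ 1` remainder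
becomes exactly the CONSTRUCTION-SHAPED classes, which are TYPED (missing-input Props), NOT attempted;
this is not "finishing BSD". This file: TOOL theorems (modular forms / period homology algebra),
0 defs, 0 facts, nothing booked; X4 CONSTRUCTION-SHAPED.

## Why (the Mazur-principle route of V43 without multiplicity one)

Gen 24 (V43) read the level-lowering certificate as the INCLUSION `E'[p] ⊆ B_ℓ`, in cohomological
form: the reduced plus functional `Φ = φ̄_f` of `f` on `H₁(X₀(Mℓ), ℤ)` lies in the `ℓ`-OLD part,
`Φ = Λ₁∘α_* + Λ₂∘β_*` for two functionals `Λ₁, Λ₂` on `H₁(X₀(M), ℤ)`. The certificate the Kurihara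
argument consumes (`PlusSymbolLevelLowersOver`, gen 20–23) is finer: `Λ₂ = −w Λ₁` with `Λ₁` an
EIGENVECTOR of `T_ℓ` (eigenvalue `ε(ℓ+1)`, `w ε = 1`). This file proves that the finer shape is
AUTOMATIC: if `Λ₁, Λ₂` are eigen for the prime-to-`Mℓ` Hecke ring `𝕋̃` (character with maximal, odd,
non-Eisenstein kernel) and `Φ` is a `U_ℓ`-eigenvector with eigenvalue `ε`, `ε² = 1`, then
`Λ₂ = −ε Λ₁` and `Λ₁∘T_ℓ^∨ = ε(ℓ+1) Λ₁` on `H₁(X₀(M), ℤ)`, hence `Φ = Λ₁∘α_* − ε Λ₁∘β_*`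
(`oldShape_of_eigenPair_of_ribet1984_iharaLemma`). Inputs: Ihara's lemma in the ANNIHILATOR form
(gen 25 K47 §5, from the named fact `ribet1984_iharaLemma`) and the action of `U_ℓ` on `ℓ`-old
forms, PROVED here from `q`-expansions:
* `heckeT_degeneracyMap0_one_of_not_dvd`: `U_ℓ [α₁] g = [α₁] T_ℓ g − [α_ℓ] g` (`ℓ ∤ M`),
* `heckeT_degeneracyMap0_self`: `U_ℓ [α_ℓ] g = ℓ · [α₁] g`
(Diamond–Shurman Prop. 5.6.2 / Atkin–Lehner §2, for `Γ₀` in weight `2`), and their transposes on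
`S₂^∨`: `α_* U_ℓ^∨ = T_ℓ^∨ α_* − β_*`, `β_* U_ℓ^∨ = ℓ α_*`.

WHAT THIS LEAVES for the corner's Mazur-principle target (V45, successor): (★) the `ℓ`-old
decomposition of `φ̄_f` with `𝕋̃`-EIGEN components (from `E'[p] ⊆ B_ℓ` + the projection to the
`𝔪`-primary part of `Hom(H₁(X₀(M),ℤ), k)` — standard artinian algebra), and the extension of `Λ₁`
from cycles to paths (boundary symbols Eisenstein, DDT Lemma 4.30 (a)).

## References

* F. Diamond, J. Shurman, *A First Course in Modular Forms* (2005), Prop. 5.6.2, §5.7. [cite: DiamondShurman2005, Prop. 5.6.2]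
* A. O. L. Atkin, J. Lehner, *Hecke operators on Γ₀(m)*, Math. Ann. 185 (1970), §2. [cite: AtkinLehner1970, §2]
* K. A. Ribet, Proc. ICM 1983 (1984), Thm. 4.1. [cite: Ribet1984ICM, Thm. 4.1]
* H. Darmon, F. Diamond, R. Taylor, *Fermat's Last Theorem* (1995), Lemma 4.28 (a), Lemma 4.30. [cite: DarmonDiamondTaylor1995, Lemma 4.28 (a), Lemma 4.30 (b), §4.5 pp. 135–137]
-/

noncomputable section

open scoped MatrixGroups ModularForm

open CongruenceSubgroup Finset Matrix PowerSeries

open Literature.NumberTheory.EllipticCurves Literature.NumberTheory.EllipticCurves.ModularForms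
  Literature.NumberTheory.EllipticCurves.ModularForms.HidaCohomology

namespace Summit.BirchSwinnertonDyer.Rank1Residual.LevelLowering

/-! ### §1 `U_ℓ` on the `ℓ`-old forms of `S₂(Γ₀(Mℓ))` -/

section Intertwining

variable {M : ℕ} [NeZero M] {ℓ : ℕ} [Fact ℓ.Prime]

/-- **`U_ℓ [α₁] g = [α₁] T_ℓ g − [α_ℓ] g`** for `g ∈ S₂(Γ₀(M))`, `ℓ ∤ M` prime, at level `Mℓ`
(`[α_d] = degeneracyMap0 M (Mℓ) d 2`; on `q`-expansions: `a_n(U_ℓ[α₁]g) = a_{ℓn}(g)` and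
`a_n([α₁]T_ℓ g) − a_n([α_ℓ]g) = (a_{ℓn}(g) + ℓ·𝟙_{ℓ∣n} a_{n/ℓ}(g)) − ℓ·𝟙_{ℓ∣n} a_{n/ℓ}(g)`;
Diamond–Shurman Prop. 5.6.2, Atkin–Lehner §2). [cite: DiamondShurman2005, Prop. 5.6.2] -/
theorem heckeT_degeneracyMap0_one_of_not_dvd (hℓM : ¬ ℓ ∣ M) (g : CuspForm (Gamma0 M) 2) :
    heckeT (Gamma0 (M * ℓ)) 2 ℓ (degeneracyMap0 M (M * ℓ) 1 2 g) =
      degeneracyMap0 M (M * ℓ) 1 2 (heckeT (Gamma0 M) 2 ℓ g) - degeneracyMap0 M (M * ℓ) ℓ 2 g := by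
  have hℓ : ℓ.Prime := Fact.out
  haveI : NeZero ℓ := ⟨hℓ.ne_zero⟩
  have h1 : M * 1 ∣ M * ℓ := by rw [mul_one]; exact dvd_mul_right M ℓ
  have hℓ' : M * ℓ ∣ M * ℓ := dvd_rfl
  have hz1 : ((1 : ℕ) : ℂ) ^ ((2 : ℤ) - 1) = 1 := by norm_num
  have hzℓ : ((ℓ : ℕ) : ℂ) ^ ((2 : ℤ) - 1) = ℓ := by norm_num
  refine eq_of_forall_cuspCoeff_eq (one_mem_strictPeriods_gamma0 (M * ℓ)) fun n ↦ ?_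
  simp only [cuspCoeff]
  rw [qExpansion_coeff_heckeT_holds (M * ℓ) 2 _ ℓ hℓ n, if_pos (dvd_mul_left ℓ M), add_zero,
    qExpansion_coeff_sub_level0, degeneracyMap0_eq_smul_iota M (M * ℓ) 1 2 h1,
    degeneracyMap0_eq_smul_iota M (M * ℓ) 1 2 h1, degeneracyMap0_eq_smul_iota M (M * ℓ) ℓ 2 hℓ',
    qExpansion_coeff_smul, qExpansion_coeff_smul, qExpansion_coeff_smul, qExpansion_coeff_iota,
    qExpansion_coeff_iota, qExpansion_coeff_iota, hz1, hzℓ, one_mul, one_mul,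
    if_pos (one_dvd _), if_pos (one_dvd _), Nat.div_one, Nat.div_one,
    qExpansion_coeff_heckeT_holds M 2 g ℓ hℓ n, if_neg hℓM, hzℓ]
  ring

/-- **`U_ℓ [α_ℓ] g = ℓ · [α₁] g`** for `g ∈ S₂(Γ₀(M))` at level `Mℓ` (`a_n(U_ℓ[α_ℓ]g) =
a_{ℓn}([α_ℓ]g) = ℓ a_n(g)`; Diamond–Shurman Prop. 5.6.2). [cite: DiamondShurman2005, Prop. 5.6.2] -/
theorem heckeT_degeneracyMap0_self (g : CuspForm (Gamma0 M) 2) :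
    heckeT (Gamma0 (M * ℓ)) 2 ℓ (degeneracyMap0 M (M * ℓ) ℓ 2 g) =
      (ℓ : ℂ) • degeneracyMap0 M (M * ℓ) 1 2 g := by
  have hℓ : ℓ.Prime := Fact.out
  haveI : NeZero ℓ := ⟨hℓ.ne_zero⟩
  have h1 : M * 1 ∣ M * ℓ := by rw [mul_one]; exact dvd_mul_right M ℓ
  have hℓ' : M * ℓ ∣ M * ℓ := dvd_rfl
  have hz1 : ((1 : ℕ) : ℂ) ^ ((2 : ℤ) - 1) = 1 := by norm_num
  have hzℓ : ((ℓ : ℕ) : ℂ) ^ ((2 : ℤ) - 1) = ℓ := by norm_num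
  refine eq_of_forall_cuspCoeff_eq (one_mem_strictPeriods_gamma0 (M * ℓ)) fun n ↦ ?_
  simp only [cuspCoeff]
  rw [qExpansion_coeff_heckeT_holds (M * ℓ) 2 _ ℓ hℓ n, if_pos (dvd_mul_left ℓ M), add_zero,
    qExpansion_coeff_smul, degeneracyMap0_eq_smul_iota M (M * ℓ) 1 2 h1,
    degeneracyMap0_eq_smul_iota M (M * ℓ) ℓ 2 hℓ', qExpansion_coeff_smul, qExpansion_coeff_smul,
    qExpansion_coeff_iota, qExpansion_coeff_iota, hz1, hzℓ, one_mul, if_pos (one_dvd _), Nat.div_one,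
    if_pos (dvd_mul_right ℓ n), Nat.mul_div_cancel_left n hℓ.pos]

/-- **`α_* ∘ U_ℓ^∨ = T_ℓ^∨ ∘ α_* − β_*`** on `S₂(Γ₀(Mℓ))^∨` (transpose of
`heckeT_degeneracyMap0_one_of_not_dvd`). [cite: DiamondShurman2005, Prop. 5.6.2] -/
theorem dualMap_degeneracyMap0_one_dualMap_heckeT (hℓM : ¬ ℓ ∣ M)
    (z : Module.Dual ℂ (CuspForm (Gamma0 (M * ℓ)) 2)) :
    (degeneracyMap0 M (M * ℓ) 1 2).dualMap ((heckeT (Gamma0 (M * ℓ)) 2 ℓ).dualMap z) =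
      (heckeT (Gamma0 M) 2 ℓ).dualMap ((degeneracyMap0 M (M * ℓ) 1 2).dualMap z) -
        (degeneracyMap0 M (M * ℓ) ℓ 2).dualMap z := by
  ext g
  simp only [LinearMap.dualMap_apply, LinearMap.sub_apply, heckeT_degeneracyMap0_one_of_not_dvd hℓM,
    map_sub]

/-- **`β_* ∘ U_ℓ^∨ = ℓ · α_*`** on `S₂(Γ₀(Mℓ))^∨` (transpose of `heckeT_degeneracyMap0_self`).
[cite: DiamondShurman2005, Prop. 5.6.2] -/
theorem dualMap_degeneracyMap0_self_dualMap_heckeT (z : Module.Dual ℂ (CuspForm (Gamma0 (M * ℓ)) 2)) :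
    (degeneracyMap0 M (M * ℓ) ℓ 2).dualMap ((heckeT (Gamma0 (M * ℓ)) 2 ℓ).dualMap z) =
      (ℓ : ℂ) • (degeneracyMap0 M (M * ℓ) 1 2).dualMap z := by
  ext g
  simp only [LinearMap.dualMap_apply, LinearMap.smul_apply, heckeT_degeneracyMap0_self, map_smul,
    smul_eq_mul]

end Intertwining

/-! ### §2 The old shape is forced -/

section OldShape

variable {k : Type*} [CommRing k] {M : ℕ} [NeZero M] {ℓ : ℕ} [Fact ℓ.Prime]

/-- A `𝕋̃`-eigen function on the lattice, additive there, is `ℤ`-homogeneous there: `Λ(n • x) = n Λ(x)`.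
[folklore] -/
theorem apply_natCast_smul_of_additive (Λ : Module.Dual ℂ (CuspForm (Gamma0 M) 2) → k)
    (h0 : Λ 0 = 0)
    (hadd : ∀ x ∈ periodHomology M, ∀ y ∈ periodHomology M, Λ (x + y) = Λ x + Λ y)
    {x : Module.Dual ℂ (CuspForm (Gamma0 M) 2)} (hx : x ∈ periodHomology M) (n : ℕ) :
    Λ ((n : ℂ) • x) = n * Λ x := by
  induction n with
  | zero => simp [h0]
  | succ n ih =>
    have hnx : ((n : ℂ) • x) ∈ periodHomology M := by
      rw [Nat.cast_smul_eq_nsmul]; exact (periodHomology M).nsmul_mem hx n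
    rw [Nat.cast_succ, add_smul, one_smul, hadd _ hnx _ hx, ih, Nat.cast_succ]
    ring

/-- **THE `ℓ`-OLD SHAPE IS FORCED.** Let `ℓ ∤ M` be prime, `Φ` a `k`-valued function on
`S₂(Γ₀(Mℓ))^∨` and `Λ₁, Λ₂` `k`-valued functions on `S₂(Γ₀(M))^∨`, additive on `H₁(X₀(M), ℤ)` and
BOTH eigen there for the prime-to-`Mℓ` Hecke ring `𝕋̃` with character `χ` (`ker χ` maximal,
`(2 : k) ≠ 0`, not Eisenstein), such that on `H₁(X₀(Mℓ), ℤ)` (★) `Φ = Λ₁∘α_* + Λ₂∘β_*` and `Φ` is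
a `U_ℓ`-eigenvector: `Φ ∘ U_ℓ^∨ = ε Φ` with `ε² = 1`. Then, with Ihara's lemma (`ribet1984_iharaLemma`,
BY NAME, annihilator form): `Λ₂ = −ε Λ₁` and `Λ₁ ∘ T_ℓ^∨ = ε(ℓ+1) Λ₁` on `H₁(X₀(M), ℤ)`, and
`Φ = Λ₁∘α_* − ε Λ₁∘β_*` on `H₁(X₀(Mℓ), ℤ)` — the `ℓ`-STABILISED shape with `Λ₁` a `T_ℓ`-EIGENVECTOR
(the pair `(Λ₁∘T_ℓ^∨ + ℓΛ₂ − εΛ₁, −Λ₁ − εΛ₂)` is `χ`-eigen and killed by `π^*`, hence zero).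
[cite: Ribet1984ICM, Thm. 4.1] [cite: DiamondShurman2005, Prop. 5.6.2]
[cite: DarmonDiamondTaylor1995, Lemma 4.28 (a), Lemma 4.30 (b), §4.5 pp. 135–137] -/
theorem oldShape_of_eigenPair_of_ribet1984_iharaLemma (hI : ribet1984_iharaLemma)
    (hℓM : ¬ ℓ ∣ M) (Φ : Module.Dual ℂ (CuspForm (Gamma0 (M * ℓ)) 2) → k)
    (Λ₁ Λ₂ : Module.Dual ℂ (CuspForm (Gamma0 M) 2) → k) (χ : HeckeRing0.primeTo M 2 (M * ℓ) →+* k)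
    (hΛ₁ : ∀ (s : HeckeRing0.primeTo M 2 (M * ℓ)), ∀ x ∈ periodHomology M,
      Λ₁ ((s : HeckeRing0 M 2) • x) = χ s * Λ₁ x)
    (hΛ₂ : ∀ (s : HeckeRing0.primeTo M 2 (M * ℓ)), ∀ x ∈ periodHomology M,
      Λ₂ ((s : HeckeRing0 M 2) • x) = χ s * Λ₂ x)
    (hadd₁ : ∀ x ∈ periodHomology M, ∀ y ∈ periodHomology M, Λ₁ (x + y) = Λ₁ x + Λ₁ y)
    (hadd₂ : ∀ x ∈ periodHomology M, ∀ y ∈ periodHomology M, Λ₂ (x + y) = Λ₂ x + Λ₂ y)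
    (h𝔫 : (RingHom.ker χ).IsMaximal) (h2 : (2 : k) ≠ 0)
    (hE : ¬ HeckeRing0.primeTo.IsEisenstein (RingHom.ker χ))
    (hΦ : ∀ z ∈ periodHomology (M * ℓ),
      Φ z = Λ₁ ((degeneracyMap0 M (M * ℓ) 1 2).dualMap z) +
        Λ₂ ((degeneracyMap0 M (M * ℓ) ℓ 2).dualMap z))
    {ε : k} (hε : ε * ε = 1)
    (hU : ∀ z ∈ periodHomology (M * ℓ), Φ ((heckeT (Gamma0 (M * ℓ)) 2 ℓ).dualMap z) = ε * Φ z) :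
    (∀ x ∈ periodHomology M, Λ₂ x = -(ε * Λ₁ x)) ∧
      (∀ x ∈ periodHomology M,
        Λ₁ ((heckeT (Gamma0 M) 2 ℓ).dualMap x) = ε * (ℓ + 1) * Λ₁ x) ∧
      ∀ z ∈ periodHomology (M * ℓ),
        Φ z = Λ₁ ((degeneracyMap0 M (M * ℓ) 1 2).dualMap z) -
          ε * Λ₁ ((degeneracyMap0 M (M * ℓ) ℓ 2).dualMap z) := by
  have hℓ : ℓ.Prime := Fact.out
  haveI : NeZero ℓ := ⟨hℓ.ne_zero⟩
  have h1 : M * 1 ∣ M * ℓ := by rw [mul_one]; exact dvd_mul_right M ℓ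
  have hℓ' : M * ℓ ∣ M * ℓ := dvd_rfl
  have h0₁ : Λ₁ 0 = 0 := apply_zero_eq_zero_of_eigen Λ₁ χ hΛ₁
  have h0₂ : Λ₂ 0 = 0 := apply_zero_eq_zero_of_eigen Λ₂ χ hΛ₂
  -- membership bookkeeping
  have hTmem : ∀ x ∈ periodHomology M, (heckeT (Gamma0 M) 2 ℓ).dualMap x ∈ periodHomology M :=
    fun x hx ↦ dualMap_heckeT_mem_periodHomology M hℓ hx
  have hαmem : ∀ z ∈ periodHomology (M * ℓ),
      (degeneracyMap0 M (M * ℓ) 1 2).dualMap z ∈ periodHomology M :=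
    fun z hz ↦ dualMap_degeneracyMap0_mem_periodHomology M (M * ℓ) 1 h1 hz
  have hβmem : ∀ z ∈ periodHomology (M * ℓ),
      (degeneracyMap0 M (M * ℓ) ℓ 2).dualMap z ∈ periodHomology M :=
    fun z hz ↦ dualMap_degeneracyMap0_mem_periodHomology M (M * ℓ) ℓ hℓ' hz
  have hsub₁ : ∀ x ∈ periodHomology M, ∀ y ∈ periodHomology M, Λ₁ (x - y) = Λ₁ x - Λ₁ y := by
    intro x hx y hy
    have h := hadd₁ (x - y) (sub_mem hx hy) y hy
    rw [sub_add_cancel] at h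
    linear_combination -h
  -- `T_ℓ^∨` commutes with `𝕋̃` on the dual space
  have hcomm : ∀ (s : HeckeRing0.primeTo M 2 (M * ℓ)) (x : Module.Dual ℂ (CuspForm (Gamma0 M) 2)),
      (heckeT (Gamma0 M) 2 ℓ).dualMap ((s : HeckeRing0 M 2) • x) =
        (s : HeckeRing0 M 2) • (heckeT (Gamma0 M) 2 ℓ).dualMap x := by
    intro s x
    have hT : (heckeT (Gamma0 M) 2 ℓ).dualMap x = HeckeRing0.T M 2 ℓ hℓ • x := by
      ext g; simp [HeckeRing0.smul_dual_apply, HeckeRing0.toEnd_T]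
    have hT' : (heckeT (Gamma0 M) 2 ℓ).dualMap ((s : HeckeRing0 M 2) • x) =
        HeckeRing0.T M 2 ℓ hℓ • ((s : HeckeRing0 M 2) • x) := by
      ext g; simp [HeckeRing0.smul_dual_apply, HeckeRing0.toEnd_T]
    rw [hT, hT', smul_smul, smul_smul, mul_comm]
  -- the two auxiliary functionals
  set Ψ₁ : Module.Dual ℂ (CuspForm (Gamma0 M) 2) → k :=
    fun x ↦ Λ₁ ((heckeT (Gamma0 M) 2 ℓ).dualMap x) + ℓ * Λ₂ x - ε * Λ₁ x with hΨ₁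
  set Ψ₂ : Module.Dual ℂ (CuspForm (Gamma0 M) 2) → k := fun x ↦ -Λ₁ x - ε * Λ₂ x with hΨ₂
  have hΨ₁e : ∀ (s : HeckeRing0.primeTo M 2 (M * ℓ)), ∀ x ∈ periodHomology M,
      Ψ₁ ((s : HeckeRing0 M 2) • x) = χ s * Ψ₁ x := by
    intro s x hx
    simp only [hΨ₁, hcomm s x, hΛ₁ s _ (hTmem x hx), hΛ₂ s x hx, hΛ₁ s x hx]
    ring
  have hΨ₂e : ∀ (s : HeckeRing0.primeTo M 2 (M * ℓ)), ∀ x ∈ periodHomology M,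
      Ψ₂ ((s : HeckeRing0 M 2) • x) = χ s * Ψ₂ x := by
    intro s x hx
    simp only [hΨ₂, hΛ₁ s x hx, hΛ₂ s x hx]
    ring
  -- `π^*(Ψ₁, Ψ₂) = Φ∘U_ℓ^∨ − εΦ = 0` on `H₁(X₀(Mℓ), ℤ)`
  have hker : ∀ z ∈ periodHomology (M * ℓ),
      Ψ₁ ((degeneracyMap0 M (M * ℓ) 1 2).dualMap z) +
        Ψ₂ ((degeneracyMap0 M (M * ℓ) ℓ 2).dualMap z) = 0 := by
    intro z hz
    have hUz : (heckeT (Gamma0 (M * ℓ)) 2 ℓ).dualMap z ∈ periodHomology (M * ℓ) :=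
      dualMap_heckeT_mem_periodHomology (M * ℓ) hℓ hz
    have h := hU z hz
    rw [hΦ _ hUz, hΦ z hz, dualMap_degeneracyMap0_one_dualMap_heckeT hℓM,
      dualMap_degeneracyMap0_self_dualMap_heckeT, hsub₁ _ (hTmem _ (hαmem z hz)) _ (hβmem z hz),
      apply_natCast_smul_of_additive Λ₂ h0₂ hadd₂ (hαmem z hz) ℓ] at h
    simp only [hΨ₁, hΨ₂]
    linear_combination h
  -- Ihara (annihilator form on eigen pairs): `Ψ₁ = Ψ₂ = 0` on `H₁(X₀(M), ℤ)`
  have hzero : ∀ x ∈ periodHomology M, Ψ₁ x = 0 ∧ Ψ₂ x = 0 := fun x hx ↦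
    apply_eq_zero_of_eigen_of_ribet1984_iharaLemma hI hℓM Ψ₁ Ψ₂ χ hΨ₁e hΨ₂e h𝔫 h2 hE hker hx
  have hΛ₂' : ∀ x ∈ periodHomology M, Λ₂ x = -(ε * Λ₁ x) := by
    intro x hx
    have h := (hzero x hx).2
    simp only [hΨ₂] at h
    -- `−Λ₁ x − ε Λ₂ x = 0` and `ε² = 1`
    linear_combination (-ε) * h - (Λ₂ x) * hε
  refine ⟨hΛ₂', fun x hx ↦ ?_, fun z hz ↦ ?_⟩
  · have h := (hzero x hx).1
    simp only [hΨ₁] at h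
    rw [hΛ₂' x hx] at h
    linear_combination h
  · rw [hΦ z hz, hΛ₂' _ (hβmem z hz)]
    ring

end OldShape

end Summit.BirchSwinnertonDyer.Rank1Residual.LevelLowering

end
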